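import Summits.Ventures.PercRepro.GZSwapB

/-!
# The K-swap of Gladkov–Zimin at the class level — part C (Theorem 8.3 (i)–(iv) on the residual `bot-2`, `bot-1 ⊆ BAD`)

Continuation of `GZSwapB`; the section `Bot2Structure` continues in `GZSwap` (the rules `R***` and `R4`).
-/

namespace PercRepro

namespace MultiGraph

/-! ### Theorem 8.3: the structure of the residual `bot-2` -/

section Bot2Structure

variable {V E : Type*} (G : MultiGraph V E)

/-- **The first exit**: if `a ~ b` in `ω'` but not in `ω`, some `ω'`-open edge at the `ω`-cluster of `a`
is `ω`-closed. -/
theorem exists_open_closed_edgesAt {ω ω' : Config E} {a b : V} (h' : G.Conn ω' a b)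
    (h : ¬ G.Conn ω a b) :
    ∃ e, ω' e = true ∧ ω e = false ∧ e ∈ G.edgesAt (G.cluster ω a) := by
  have key : b ∈ G.cluster ω a ∨ ∃ e, ω' e = true ∧ ω e = false ∧ e ∈ G.edgesAt (G.cluster ω a) := by
    refine Conn.induction (motive := fun x => x ∈ G.cluster ω a ∨
      ∃ e, ω' e = true ∧ ω e = false ∧ e ∈ G.edgesAt (G.cluster ω a))
      (Or.inl (G.self_mem_cluster ω a)) (fun {x y} _ hxy hx => ?_) h'
    rcases hx with hx | hx
    · obtain ⟨e, he, hend⟩ := hxy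
      cases hωe : ω e
      · refine Or.inr ⟨e, he, hωe, ?_⟩
        rw [mem_edgesAt]
        rcases hend with ⟨h1, _⟩ | ⟨_, h2⟩
        · exact Or.inl (h1 ▸ hx)
        · exact Or.inr (h2 ▸ hx)
      · left
        rcases hend with ⟨h1, h2⟩ | ⟨h1, h2⟩
        · rw [← h2]; exact G.snd_mem_cluster_of_open hωe (h1 ▸ hx)
        · rw [← h1]; exact G.fst_mem_cluster_of_open hωe (h2 ▸ hx)
    · exact Or.inr hx
  rcases key with hb | hex
  · exact absurd hb h
  · exact hex

/-- The sealed swap and the K-swap differ exactly on the edges at both `K` and `M`. -/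
theorem kSwap_eq_kSwapSealed_of_not_both {a c : V} {ω : Config E} {e : E}
    (h : ¬ (e ∈ G.edgesAt (G.cluster ω a) ∧ e ∈ G.edgesAt (G.cluster ω c))) :
    G.kSwap a ω e = G.kSwapSealed a c ω e := by
  by_cases hK : e ∈ G.edgesAt (G.cluster ω a)
  · have hM : e ∉ G.edgesAt (G.cluster ω c) := fun hM => h ⟨hK, hM⟩
    rw [G.kSwap_apply_of_mem hK, G.kSwapSealed_apply_of_flip hK hM]
  · rw [G.kSwap_apply_of_notMem hK, G.kSwapSealed_apply_of_notMem hK]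

variable {G}

/-- `Q` is closed under `τ`-open edges: both endpoints of a `τ`-open edge at `Q` lie in `Q`. -/
theorem mem_cluster_both_of_open {ω : Config E} {x : V} {e : E} (he : ω e = true)
    (h : e ∈ G.edgesAt (G.cluster ω x)) :
    G.fst e ∈ G.cluster ω x ∧ G.snd e ∈ G.cluster ω x := by
  rcases h with h | h
  · exact ⟨h, G.snd_mem_cluster_of_open he h⟩
  · exact ⟨G.fst_mem_cluster_of_open he h, h⟩

/-- **`σ₇₂(S) ⊆ σ₀(S)` whenever `a ≁_S c`**: an edge at both `K = Com_a(S)` and `M = Com_c(S)` is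
`S`-closed (an open edge at `K` and at `M` would merge the two clusters), so on those edges the sealed
swap keeps `closed` where the K-swap opens; on every other edge the two swaps agree. -/
theorem kSwapSealed_le_kSwap_of_not_conn {a c : V} {ω : Config E} (hac : ¬ G.Conn ω a c) :
    G.kSwapSealed a c ω ≤ G.kSwap a ω := by
  intro e
  by_cases hboth : e ∈ G.edgesAt (G.cluster ω a) ∧ e ∈ G.edgesAt (G.cluster ω c)
  · have hωe : ω e = false := by
      cases hωe : ω e
      · rfl
      · exfalso
        have h1 := (mem_cluster_both_of_open hωe hboth.1).1
        have h2 := (mem_cluster_both_of_open hωe hboth.2).1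
        exact hac (G.mem_cluster_of_mem_inter h1 h2)
    rw [G.kSwapSealed_apply_of_mem_c hboth.2, G.kSwap_apply_of_mem hboth.1, hωe]
    exact Bool.false_le _
  · rw [G.kSwap_eq_kSwapSealed_of_not_both hboth]

/-- **`bot-1 ⊆ BAD`** (ref-1's note on §8.9, where `bot-1` is defined without «bad»): in the cell `bot`,
a configuration whose sealed swap joins `a` and `b` is bad — `σ₇₂(S) ⊆ σ₀(S)` and connection is
monotone. -/
theorem bad_of_isBot_of_conn_kSwapSealed {a b c : V} {ω : Config E} (h : G.IsBot ω a b c)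
    (hab : G.Conn (G.kSwapSealed a c ω) a b) : G.Bad ω a b :=
  ⟨h.1, Conn.mono (kSwapSealed_le_kSwap_of_not_conn h.2.1) hab⟩

/-- The cell `bot` splits into `bot-1` (the sealed swap joins `a` and `b`) and `bot-2` (it does not):
every bad `bot` configuration that is not `bot-2` is `bot-1`, and `bot-1` is bad. -/
theorem bot2_or_conn_kSwapSealed_of_isBot {a b c : V} {ω : Config E} (h : G.IsBot ω a b c)
    (hbad : G.Bad ω a b) :
    G.Bot2 ω a b c ∨ G.Conn (G.kSwapSealed a c ω) a b := by
  by_cases hab : G.Conn (G.kSwapSealed a c ω) a b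
  · exact Or.inr hab
  · exact Or.inl ⟨hbad, h, hab⟩

/-- **Theorem 8.3 (i), first half**: for `S ∈ bot-2`, `Q ∩ L = ∅` — `Q = Com_a(σ₇₂ S)` misses the cluster
of `b`. -/
theorem not_mem_cluster_b_of_bot2 {a b c : V} {ω : Config E} (h : G.Bot2 ω a b c) {v : V}
    (hv : v ∈ G.cluster (G.kSwapSealed a c ω) a) : v ∉ G.cluster ω b := by
  intro hvL
  -- `L` stays connected in `σ₇₂`: its open edges are not at `K`
  have hL : G.Conn (G.kSwapSealed a c ω) b v := by
    refine conn_of_open_edges (fun e he heL => ?_) (hvL : G.Conn ω b v)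
    have hK : e ∉ G.edgesAt (G.cluster ω a) := by
      intro heK
      exact h.2.1.1 (G.mem_cluster_of_open_edgesAt he heK heL)
    rw [G.kSwapSealed_apply_of_notMem hK]
    exact he
  exact h.2.2 ((hv : G.Conn _ a v).trans hL.symm)

/-- **Theorem 8.3 (i), second half**: `Q ∩ M = ∅`. -/
theorem not_mem_cluster_c_of_bot2 {a b c : V} {ω : Config E} (h : G.Bot2 ω a b c) {v : V}
    (hv : v ∈ G.cluster (G.kSwapSealed a c ω) a) : v ∉ G.cluster ω c := by
  intro hvM
  rw [← G.cluster_kSwapSealed_c a c ω] at hvM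
  have hac : G.Conn (G.kSwapSealed a c ω) a c := (hv : G.Conn _ a v).trans (hvM : G.Conn _ c v).symm
  have : a ∈ G.cluster (G.kSwapSealed a c ω) c := hac.symm
  rw [G.cluster_kSwapSealed_c] at this
  exact h.2.1.2.1 (this : G.Conn ω c a).symm

/-- **Theorem 8.3 (ii)**: no edge joins `Q ∩ K` to `L` (either orientation). -/
theorem no_edge_Q_K_L_of_bot2 {a b c : V} {ω : Config E} (h : G.Bot2 ω a b c) (e : E) {u v : V}
    (huQ : u ∈ G.cluster (G.kSwapSealed a c ω) a) (huK : u ∈ G.cluster ω a)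
    (hvL : v ∈ G.cluster ω b) (hend : (G.fst e = u ∧ G.snd e = v) ∨ (G.fst e = v ∧ G.snd e = u)) :
    False := by
  have hab : ¬ G.Conn ω a b := h.2.1.1
  have hac : ¬ G.Conn ω a c := h.2.1.2.1
  have hbc : ¬ G.Conn ω b c := h.2.1.2.2
  have heK : e ∈ G.edgesAt (G.cluster ω a) := by
    rcases hend with ⟨h1, _⟩ | ⟨_, h2⟩
    · exact Or.inl (h1 ▸ huK)
    · exact Or.inr (h2 ▸ huK)
  have heL : e ∈ G.edgesAt (G.cluster ω b) := by
    rcases hend with ⟨_, h2⟩ | ⟨h1, _⟩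
    · exact Or.inr (h2 ▸ hvL)
    · exact Or.inl (h1 ▸ hvL)
  -- the edge is closed in `ω` (an open edge at `K` and at `L` would join `a` and `b`)
  have hωe : ω e = false := by
    cases hωe : ω e
    · rfl
    · exact absurd (G.mem_cluster_of_open_edgesAt hωe heK heL) (fun hbK =>
        hab (hbK : G.Conn ω a b))
  -- not at `M`
  have heM : e ∉ G.edgesAt (G.cluster ω c) := by
    intro heM
    have huM : u ∉ G.cluster ω c := fun hM => hac ((huK : G.Conn ω a u).trans (hM : G.Conn ω c u).symm)
    have hvM : v ∉ G.cluster ω c := fun hM => hbc ((hvL : G.Conn ω b v).trans (hM : G.Conn ω c v).symm)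
    rcases heM with hM | hM <;> rcases hend with ⟨h1, h2⟩ | ⟨h1, h2⟩
    · exact huM (h1 ▸ hM)
    · exact hvM (h1 ▸ hM)
    · exact hvM (h2 ▸ hM)
    · exact huM (h2 ▸ hM)
  -- so it is flipped open by `σ₇₂`, and `v ∈ Q`
  have hopen : G.kSwapSealed a c ω e = true := by
    rw [G.kSwapSealed_apply_of_flip heK heM, hωe]
    rfl
  have heQ : e ∈ G.edgesAt (G.cluster (G.kSwapSealed a c ω) a) := by
    rcases hend with ⟨h1, _⟩ | ⟨_, h2⟩
    · exact Or.inl (h1 ▸ huQ)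
    · exact Or.inr (h2 ▸ huQ)
  obtain ⟨hfQ, hsQ⟩ := G.mem_cluster_both_of_open hopen heQ
  rcases hend with ⟨_, h2⟩ | ⟨h1, _⟩
  · exact not_mem_cluster_b_of_bot2 h (h2 ▸ hsQ) hvL
  · exact not_mem_cluster_b_of_bot2 h (h1 ▸ hfQ) hvL

/-- **Theorem 8.3 (iii)**: some `ω`-closed edge joins `Q ∩ K` to `M`. -/
theorem exists_edge_Q_K_M_of_bot2 {a b c : V} {ω : Config E} (h : G.Bot2 ω a b c) :
    ∃ e, ω e = false ∧
      ((G.fst e ∈ G.cluster (G.kSwapSealed a c ω) a ∧ G.fst e ∈ G.cluster ω a ∧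
          G.snd e ∈ G.cluster ω c) ∨
        (G.snd e ∈ G.cluster (G.kSwapSealed a c ω) a ∧ G.snd e ∈ G.cluster ω a ∧
          G.fst e ∈ G.cluster ω c)) := by
  obtain ⟨e, he', he, heQ⟩ := G.exists_open_closed_edgesAt h.1.2 h.2.2
  -- the two swaps differ at `e`, so `e` is at `K` and at `M`
  have hboth : e ∈ G.edgesAt (G.cluster ω a) ∧ e ∈ G.edgesAt (G.cluster ω c) := by
    by_contra hn
    have := G.kSwap_eq_kSwapSealed_of_not_both hn
    rw [he', he] at this
    exact absurd this (by decide)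
  have hωe : ω e = false := by
    have := G.kSwap_apply_of_mem hboth.1
    rw [he'] at this
    cases hω : ω e
    · rfl
    · rw [hω] at this; exact absurd this (by decide)
  refine ⟨e, hωe, ?_⟩
  have hKM : ∀ v, v ∈ G.cluster ω a → v ∉ G.cluster ω c := fun v hv hv' =>
    h.2.1.2.1 ((hv : G.Conn ω a v).trans (hv' : G.Conn ω c v).symm)
  rcases hboth.1 with hK | hK <;> rcases hboth.2 with hM | hM
  · exact absurd hM (hKM _ hK)
  · left
    refine ⟨?_, hK, hM⟩
    rcases heQ with hQ | hQ
    · exact hQ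
    · exact absurd hM (not_mem_cluster_c_of_bot2 h hQ)
  · right
    refine ⟨?_, hK, hM⟩
    rcases heQ with hQ | hQ
    · exact absurd hM (not_mem_cluster_c_of_bot2 h hQ)
    · exact hQ
  · exact absurd hM (hKM _ hK)


/-- The `Q`-paths of `σ₇₂(S)` survive in `σ₄₀(S)` (`L` sealed instead of `M`): for `S ∈ bot-2` a
`σ₇₂`-open edge at `Q` is `σ₄₀`-open. -/
theorem kSwapSealed_b_open_of_Q_open {a b c : V} {ω : Config E} (h : G.Bot2 ω a b c) {e : E}
    (he : G.kSwapSealed a c ω e = true)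
    (heQ : e ∈ G.edgesAt (G.cluster (G.kSwapSealed a c ω) a)) : G.kSwapSealed a b ω e = true := by
  obtain ⟨hfQ, hsQ⟩ := G.mem_cluster_both_of_open he heQ
  by_cases hK : e ∈ G.edgesAt (G.cluster ω a)
  · have hM : e ∉ G.edgesAt (G.cluster ω c) := by
      rintro (hM | hM)
      · exact not_mem_cluster_c_of_bot2 h hfQ hM
      · exact not_mem_cluster_c_of_bot2 h hsQ hM
    have hL : e ∉ G.edgesAt (G.cluster ω b) := by
      rintro (hL | hL)
      · exact not_mem_cluster_b_of_bot2 h hfQ hL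
      · exact not_mem_cluster_b_of_bot2 h hsQ hL
    rw [G.kSwapSealed_apply_of_flip hK hM] at he
    rw [G.kSwapSealed_apply_of_flip hK hL]
    exact he
  · rw [G.kSwapSealed_apply_of_notMem hK] at he
    rw [G.kSwapSealed_apply_of_notMem hK]
    exact he

/-- **Theorem 8.3 (iv)**: for `S ∈ bot-2` the swap `σ₄₀(S)` (the edges at `K` not at `L` flipped) has the
cell `ac|b`: `a ~ c` and `a ≁ b`. -/
theorem cell_kSwapSealed_b_of_bot2 {a b c : V} {ω : Config E} (h : G.Bot2 ω a b c) :
    G.Conn (G.kSwapSealed a b ω) a c ∧ ¬ G.Conn (G.kSwapSealed a b ω) a b := by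
  have hab : ¬ G.Conn ω a b := h.2.1.1
  have hac : ¬ G.Conn ω a c := h.2.1.2.1
  have hbc : ¬ G.Conn ω b c := h.2.1.2.2
  refine ⟨?_, fun hab' => ?_⟩
  · obtain ⟨e, hωe, hend⟩ := exists_edge_Q_K_M_of_bot2 h
    -- the `Q ∩ K`-endpoint `u` and the `M`-endpoint `m`
    have key : ∀ u m : V, u ∈ G.cluster (G.kSwapSealed a c ω) a → u ∈ G.cluster ω a →
        m ∈ G.cluster ω c → ((G.fst e = u ∧ G.snd e = m) ∨ (G.fst e = m ∧ G.snd e = u)) →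
        G.Conn (G.kSwapSealed a b ω) a c := by
      intro u m huQ huK hmM hend
      -- (1) `a ~ u` in `σ₄₀`
      have h1 : G.Conn (G.kSwapSealed a b ω) a u :=
        conn_of_open_edges (fun e' he' he'Q => G.kSwapSealed_b_open_of_Q_open h he' he'Q) huQ
      -- (2) the edge `e` is open in `σ₄₀`
      have heK : e ∈ G.edgesAt (G.cluster ω a) := by
        rcases hend with ⟨h1, _⟩ | ⟨_, h2⟩
        · exact Or.inl (h1 ▸ huK)
        · exact Or.inr (h2 ▸ huK)
      have heL : e ∉ G.edgesAt (G.cluster ω b) := by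
        have huL : u ∉ G.cluster ω b := fun hL => hab ((huK : G.Conn ω a u).trans (hL : G.Conn ω b u).symm)
        have hmL : m ∉ G.cluster ω b := fun hL => hbc ((hL : G.Conn ω b m).trans (hmM : G.Conn ω c m).symm)
        rintro (hL | hL)
        · rcases hend with ⟨h1, _⟩ | ⟨h1, _⟩
          · exact huL (h1 ▸ hL)
          · exact hmL (h1 ▸ hL)
        · rcases hend with ⟨_, h2⟩ | ⟨_, h2⟩
          · exact hmL (h2 ▸ hL)
          · exact huL (h2 ▸ hL)
      have he40 : G.kSwapSealed a b ω e = true := by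
        rw [G.kSwapSealed_apply_of_flip heK heL, hωe]
        rfl
      have h2 : G.Conn (G.kSwapSealed a b ω) u m := Conn.of_openAdj ⟨e, he40, hend⟩
      -- (3) `c ~ m` in `σ₄₀`: the open edges at `M` are not at `K`
      have h3 : G.Conn (G.kSwapSealed a b ω) c m := by
        refine conn_of_open_edges (fun e'' he'' he''M => ?_) (hmM : G.Conn ω c m)
        have hK'' : e'' ∉ G.edgesAt (G.cluster ω a) := fun hK'' =>
          hac (G.mem_cluster_of_open_edgesAt he'' hK'' he''M)
        rw [G.kSwapSealed_apply_of_notMem hK'']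
        exact he''
      exact (h1.trans h2).trans h3.symm
    rcases hend with ⟨hQ, hK, hM⟩ | ⟨hQ, hK, hM⟩
    · exact key _ _ hQ hK hM (Or.inl ⟨rfl, rfl⟩)
    · exact key _ _ hQ hK hM (Or.inr ⟨rfl, rfl⟩)
  · have : a ∈ G.cluster (G.kSwapSealed a b ω) b := hab'.symm
    rw [G.cluster_kSwapSealed_c] at this
    exact hab (this : G.Conn ω b a).symm


end Bot2Structure

end MultiGraph

end PercRepro
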